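import Mathlib
import Summits.Ventures.PercRepro2.Defs
import Summits.Ventures.PercRepro2.Graph
import Summits.Ventures.PercRepro2.OneColourSwitch
import Summits.Ventures.PercRepro2.RegionHubSign
import Summits.Ventures.PercRepro2.SideSwitch
import Summits.Ventures.PercRepro2.SideSwitchFibre
import Summits.Ventures.PercRepro2.SideSwitchClosed
import Summits.Ventures.PercRepro2.SideSwitchComps
import Summits.Ventures.PercRepro2.M9NoPocketDefs
import Summits.Ventures.PercRepro2.M9NoPocketWorld
import Summits.Ventures.PercRepro2.M9NoPocketFibre
import Summits.Ventures.PercRepro2.M9NoPocketCompl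
import Summits.Ventures.PercRepro2.M9RegionSplit
import Summits.Ventures.PercRepro2.M9PocketCubeDefs
import Summits.Ventures.PercRepro2.M9PocketCubeFibre
import Summits.Ventures.PercRepro2.M9PocketCubeCompl
import Summits.Ventures.PercRepro2.M9PocketCubeHub
import Summits.Ventures.PercRepro2.M9PocketCubeWorldMono
import Summits.Ventures.PercRepro2.M9DeadEnd
import Summits.Ventures.PercRepro2.M9DeadEndMono
import Summits.Ventures.PercRepro2.M9DeadEndHarris
import Summits.Ventures.PercRepro2.M9LinkedHubCube
import Summits.Ventures.PercRepro2.M9LinkedGroup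
import Summits.Ventures.PercRepro2.M9LinkedGroupClosed
import Summits.Ventures.PercRepro2.M9LinkedGroupLegal
import Summits.Ventures.PercRepro2.M9GeneralDSplit
import Summits.Ventures.PercRepro2.M9GeneralDHD
import Summits.Ventures.PercRepro2.M9LinkedHD

/-!
# The `W`-defect is antitone on the group interval (blind cell PercRepro2, p3 g29, 2026-08-28;
step (iii) of the `Y`-pocket-group plan, part 3)

On the group interval of a `Sep`, `K`-side point `x`: a `W`-edge at `d` stays `W` downwards
(`assignX_d_edge_false_of_le`, with `d ∉ M₂` above), a `W`-connection of `d` to a vertex of `K₂`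
persists downwards — the vertex is a block vertex of an unswitched block or a vertex of the
`Y`-pocket of `x`, both still in `K₂` below (`conn_compl_d_anti_of_mem_groupInterval`,
`mem_K2_of_K2_of_le`) — so the `W`-defect `WDefect` of `M9GeneralDHD` is antitone on the interval
(`wDefect_anti_of_mem_groupInterval`), and the `K`-side `HD` colourings with `r ~_Y s` form a
down-set of the interval (`hdKY_anti_of_mem_groupInterval`).  Own work; std axioms.
-/

namespace Summit.Ventures.PercRepro2

namespace NoPocket

open Finset Classical RegionHub OneColourSwitch SideSwitch TermSwitch

variable {V : Type*} {E : Type*}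

section Anti

variable [Fintype V] [DecidableEq V] [Fintype E] [DecidableEq E] {ends : E → Sym2 V}
  {p q r s d : V}

/-- **A `W`-edge at `d` stays `W` downwards** on the cube when `d ∉ M₂` at the upper point. -/
lemma assignX_d_edge_false_of_le (hr : d ≠ r) (hs : d ≠ s) {ρ : Config E}
    (hρ : ρ ∈ RepP ends p q r s d) {x x' : Finset (Finset V) × Finset E} (hxx' : x ≤ x')
    (hx : x ∈ cubeP ends d r s ρ) (hx' : x' ∈ cubeP ends d r s ρ) {e : E} {u : V}
    (he : ends e = s(d, u)) (hM' : d ∉ M2 ends r s (assignX ends x' ρ))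
    (hW : assignX ends x' ρ e = false) : assignX ends x ρ e = false := by
  obtain ⟨hρD, hρP⟩ := mem_RepP.1 hρ
  obtain ⟨hT, hF⟩ := mem_cubeP.1 hx
  obtain ⟨hT', hF'⟩ := mem_cubeP.1 hx'
  have hdu : Conn ends (OneColourSwitch.compl (assignX ends x' ρ)) d u := by
    refine conn_of_openAdj ⟨e, ?_, he⟩
    simp only [OneColourSwitch.compl]
    rw [hW]
    rfl
  rcases edge_trichotomy hr hs hρD e with h1 | ⟨C, hC, z, hz, w, hzw⟩ | h1
  · exact absurd h1 (not_within_rs_of_d_edge hr hs he)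
  · -- the edge touches the block `C` at `z`; `z ≠ d`, so `z = u`
    have hzne := (block_vertex_ne hρD hC hz hr hs).2.2
    have hu : u ∈ C := by
      rw [he, Sym2.eq_iff] at hzw
      rcases hzw with ⟨h1, _⟩ | ⟨_, h1⟩
      · exact absurd h1.symm hzne
      · rw [h1]; exact hz
    rw [assignX_block_edge' hρD hT hF hr hs hC hu he]
    rw [assignX_block_edge' hρD hT' hF' hr hs hC hu he] at hW
    by_cases hC' : C ∈ x'.1
    · -- `C` switched at `x'`: `u ∈ M₂(G − d)`, so `d ∈ M₂` — impossible
      exfalso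
      apply hM'
      have huM : u ∈ M2 (endsD ends d) r s (assignX ends x' ρ) := by
        rw [M2_endsD_assignX' hr hs hρD hT' hF']
        exact Or.inr (Finset.mem_coe.2 (mem_unionT.2 ⟨C, hC', hu⟩))
      rcases mem_M2_iff.1 huM with h2 | h2
      · exact mem_M2_iff.2 (Or.inl (conn_trans (conn_of_conn_endsD h2) (conn_symm hdu)))
      · exact mem_M2_iff.2 (Or.inr (conn_trans (conn_of_conn_endsD h2) (conn_symm hdu)))
    · have hCx : C ∉ x.1 := fun h => hC' (hxx'.1 h)
      rw [if_neg hC'] at hW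
      rw [if_neg hCx]
      exact hW
  · rcases mem_freeE.1 h1 with hTe | hPe
    · -- a `T`-edge, `W` at `x'`: `d ∈ M₂` — impossible
      exfalso
      apply hM'
      have hu' : u = r ∨ u = s := by
        rcases mem_Tset.1 hTe with h2 | h2 <;> rw [he, Sym2.eq_iff] at h2
        · rcases h2 with ⟨_, h3⟩ | ⟨h3, _⟩
          · exact Or.inl h3
          · exact absurd h3 hr
        · rcases h2 with ⟨_, h3⟩ | ⟨h3, _⟩
          · exact Or.inr h3
          · exact absurd h3 hs
      rcases hu' with h | h
      · rw [h] at hdu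
        exact mem_M2_iff.2 (Or.inl (conn_symm hdu))
      · rw [h] at hdu
        exact mem_M2_iff.2 (Or.inr (conn_symm hdu))
    · -- a pocket edge: `W` in the representative, flipped iff in `x.2`
      rw [assignX_Pk hρD hT hPe]
      rw [assignX_Pk hρD hT' hPe] at hW
      have hρe : ρ e = false := hρP e hPe
      by_cases hex' : e ∈ x'.2
      · rw [if_pos hex', hρe] at hW
        exact absurd hW (by decide)
      · rw [if_neg (fun h => hex' (hxx'.2 h))]
        exact hρe


/-- A vertex of `K₂` other than `r, s, d` at a point of the group interval lies in the `Y`-world of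
`G − d` or in the `Y`-pocket of `x`. -/
lemma mem_K2_endsD_or_pocketY_of_mem_K2 (hr : d ≠ r) (hs : d ≠ s) {ρ : Config E}
    (hρ : ρ ∈ RepP ends p q r s d) {x y : Finset (Finset V) × Finset E}
    (hx : x ∈ cubeP ends d r s ρ) (h : y ∈ groupInterval ends d r s ρ x) {v : V} (hvd : v ≠ d)
    (hv : v ∈ K2 ends r s (assignX ends y ρ)) :
    v ∈ K2 (endsD ends d) r s (assignX ends y ρ) ∨ v ∈ pocketY ends d r s ρ x := by
  obtain ⟨hρD, _⟩ := mem_RepP.1 hρ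
  obtain ⟨hT, hF⟩ := mem_cubeP.1 (mem_cubeP_of_mem_groupInterval h)
  by_cases hvK : v ∈ K2 (endsD ends d) r s (assignX ends y ρ)
  · exact Or.inl hvK
  · right
    -- the `Y`-connection of `v` passes through `d`
    have hdv : Conn ends (assignX ends y ρ) d v := by
      rcases mem_K2_iff.1 hv with h1 | h1
      · by_cases hrd : Conn ends (assignX ends y ρ) r d
        · exact conn_trans (conn_symm hrd) h1
        · exact absurd (mem_K2_iff.2 (Or.inl (conn_endsD_of_not_conn h1 hrd))) hvK
      · by_cases hsd : Conn ends (assignX ends y ρ) s d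
        · exact conn_trans (conn_symm hsd) h1
        · exact absurd (mem_K2_iff.2 (Or.inr (conn_endsD_of_not_conn h1 hsd))) hvK
    obtain ⟨e, u, hends, he, hvu⟩ := conn_d_decomp hvd (conn_symm hdv)
    rcases edge_trichotomy hr hs hρD e with h1 | ⟨C, hC, z, hz, w, hzw⟩ | h1
    · exact absurd h1 (not_within_rs_of_d_edge hr hs hends)
    · exfalso
      have hzne := (block_vertex_ne hρD hC hz hr hs).2.2
      have hu : u ∈ C := by
        rw [hends, Sym2.eq_iff] at hzw
        rcases hzw with ⟨h2, _⟩ | ⟨_, h2⟩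
        · exact absurd h2.symm hzne
        · rw [h2]
          exact hz
      have hCy : C ∉ y.1 := notMem_fst_of_adj_d_of_mem_groupInterval h hC hends hu
      have huK : u ∈ K2 (endsD ends d) r s (assignX ends y ρ) := by
        rw [K2_endsD_assignX' hr hs hρD hT hF]
        refine ⟨mem_K2_endsD_of_mem_block hρD hC hu, fun huT => ?_⟩
        obtain ⟨C', hC', huC'⟩ := mem_unionT.1 (Finset.mem_coe.1 huT)
        exact hCy (block_eq_of_mem hC (hT hC') hu huC' ▸ hC')
      apply hvK
      rcases mem_K2_iff.1 huK with h2 | h2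
      · exact mem_K2_iff.2 (Or.inl (conn_trans h2 (conn_symm hvu)))
      · exact mem_K2_iff.2 (Or.inr (conn_trans h2 (conn_symm hvu)))
    · rcases mem_freeE.1 h1 with hTe | hPe
      · exfalso
        apply hvK
        rcases mem_Tset.1 hTe with h2 | h2 <;> rw [hends, Sym2.eq_iff] at h2
        · rcases h2 with ⟨_, h3⟩ | ⟨h3, _⟩
          · rw [h3] at hvu
            exact mem_K2_iff.2 (Or.inl (conn_symm hvu))
          · exact absurd h3 hr
        · rcases h2 with ⟨_, h3⟩ | ⟨h3, _⟩
          · rw [h3] at hvu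
            exact mem_K2_iff.2 (Or.inr (conn_symm hvu))
          · exact absurd h3 hs
      · exact mem_pocketY_of_conn_endsD hr hs hρ hx h
          (mem_pocketY_of_pocket_edge_d hρD hx h hends hPe he) (conn_symm hvu)

/-- Membership in `K₂` of a vertex other than `d` persists downwards on the group interval of a
`K`-side point. -/
lemma mem_K2_of_K2_of_le (hr : d ≠ r) (hs : d ≠ s) {ρ : Config E}
    (hρ : ρ ∈ RepP ends p q r s d) {x y y' : Finset (Finset V) × Finset E}
    (hx : x ∈ cubeP ends d r s ρ) (hKx : d ∈ K2 ends r s (assignX ends x ρ))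
    (hy : y ∈ groupInterval ends d r s ρ x) (hy' : y' ∈ groupInterval ends d r s ρ x)
    (hyy' : y ≤ y') {v : V} (hvd : v ≠ d) (hv : v ∈ K2 ends r s (assignX ends y' ρ)) :
    v ∈ K2 ends r s (assignX ends y ρ) := by
  obtain ⟨hρD, _⟩ := mem_RepP.1 hρ
  obtain ⟨hT, hF⟩ := mem_cubeP.1 (mem_cubeP_of_mem_groupInterval hy)
  obtain ⟨hT', hF'⟩ := mem_cubeP.1 (mem_cubeP_of_mem_groupInterval hy')
  rcases mem_K2_endsD_or_pocketY_of_mem_K2 hr hs hρ hx hy' hvd hv with h1 | h1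
  · -- a block vertex of an unswitched block stays in the `Y`-world of `G − d`
    rw [K2_endsD_assignX' hr hs hρD hT' hF'] at h1
    have h2 : v ∈ K2 (endsD ends d) r s (assignX ends y ρ) := by
      rw [K2_endsD_assignX' hr hs hρD hT hF]
      exact ⟨h1.1, fun hv' => h1.2 (Finset.mem_coe.2 (unionT_mono hyy'.1 (Finset.mem_coe.1 hv')))⟩
    rcases mem_K2_iff.1 h2 with h3 | h3
    · exact mem_K2_iff.2 (Or.inl (conn_of_conn_endsD h3))
    · exact mem_K2_iff.2 (Or.inr (conn_of_conn_endsD h3))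
  · -- a vertex of the `Y`-pocket is `Y`-joined to `d ∈ K₂`
    have h1' : v ∈ pocketY ends d r s ρ y := by
      rw [pocketY_eq_of_mem_groupInterval hρD hx hy]
      exact h1
    have hdv : Conn ends (assignX ends y ρ) d v := conn_d_of_mem_pocketY h1'
    have hK := mem_K2_of_mem_groupInterval hr hs hρ hx hKx hy
    rcases mem_K2_iff.1 hK with h3 | h3
    · exact mem_K2_iff.2 (Or.inl (conn_trans h3 hdv))
    · exact mem_K2_iff.2 (Or.inr (conn_trans h3 hdv))

/-- A `W`-connection of `d` persists downwards on the group interval. -/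
lemma conn_compl_d_anti_of_mem_groupInterval (hr : d ≠ r) (hs : d ≠ s) {ρ : Config E}
    (hρ : ρ ∈ RepP ends p q r s d) {x y y' : Finset (Finset V) × Finset E}
    (hy : y ∈ groupInterval ends d r s ρ x) (hy' : y' ∈ groupInterval ends d r s ρ x)
    (hyy' : y ≤ y') {v : V} (hvd : v ≠ d)
    (hc : Conn ends (OneColourSwitch.compl (assignX ends y' ρ)) d v) :
    Conn ends (OneColourSwitch.compl (assignX ends y ρ)) d v := by
  have hM' := not_mem_M2_of_mem_groupInterval hr hs hρ hy'
  have hcy := mem_cubeP_of_mem_groupInterval hy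
  have hcy' := mem_cubeP_of_mem_groupInterval hy'
  obtain ⟨e, u, hends, he, hvu⟩ := conn_d_decomp hvd (conn_symm hc)
  -- the `W`-edge `e` at `d` stays `W`, and `u ∉ M₂(G − d)` above (else `d ∈ M₂`)
  have he' : assignX ends y' ρ e = false := by
    simp only [OneColourSwitch.compl] at he
    rw [Bool.not_eq_true'] at he
    exact he
  have hey : assignX ends y ρ e = false :=
    assignX_d_edge_false_of_le hr hs hρ hyy' hcy hcy' hends hM' he'
  have huM : u ∉ M2 (endsD ends d) r s (assignX ends y' ρ) := by
    intro huM
    apply hM'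
    have hdu : Conn ends (OneColourSwitch.compl (assignX ends y' ρ)) d u :=
      conn_of_openAdj ⟨e, he, hends⟩
    rcases mem_M2_iff.1 huM with h2 | h2
    · exact mem_M2_iff.2 (Or.inl (conn_trans (conn_of_conn_endsD h2) (conn_symm hdu)))
    · exact mem_M2_iff.2 (Or.inr (conn_trans (conn_of_conn_endsD h2) (conn_symm hdu)))
  have hvu' : Conn (endsD ends d) (OneColourSwitch.compl (assignX ends y ρ)) u v :=
    conn_endsD_compl_assignX_anti hr hs hρ hyy' hcy hcy' huM (conn_symm hvu)
  have hdu : Conn ends (OneColourSwitch.compl (assignX ends y ρ)) d u := by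
    refine conn_of_openAdj ⟨e, ?_, hends⟩
    simp only [OneColourSwitch.compl]
    rw [hey]
    rfl
  exact conn_trans hdu (conn_of_conn_endsD hvu')

/-- **The `W`-defect is antitone on the group interval** of a `K`-side point. -/
theorem wDefect_anti_of_mem_groupInterval (hr : d ≠ r) (hs : d ≠ s) (hpd : p ≠ d) (hqd : q ≠ d)
    {ρ : Config E} (hρ : ρ ∈ RepP ends p q r s d) {x y y' : Finset (Finset V) × Finset E}
    (hx : x ∈ cubeP ends d r s ρ) (hKx : d ∈ K2 ends r s (assignX ends x ρ))
    (hy : y ∈ groupInterval ends d r s ρ x) (hy' : y' ∈ groupInterval ends d r s ρ x)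
    (hyy' : y ≤ y') (h : WDefect ends p q r s d (assignX ends y' ρ)) :
    WDefect ends p q r s d (assignX ends y ρ) := by
  rcases h with h1 | h1 | ⟨v, hvr, hvs, hvd, hvK, hvc⟩
  · exact Or.inl (conn_compl_d_anti_of_mem_groupInterval hr hs hρ hy hy' hyy' hpd h1)
  · exact Or.inr (Or.inl (conn_compl_d_anti_of_mem_groupInterval hr hs hρ hy hy' hyy' hqd h1))
  · exact Or.inr (Or.inr ⟨v, hvr, hvs, hvd, mem_K2_of_K2_of_le hr hs hρ hx hKx hy hy' hyy' hvd hvK,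
      conn_compl_d_anti_of_mem_groupInterval hr hs hρ hy hy' hyy' hvd hvc⟩)

/-- On the group interval of a `Sep`, `K`-side point, «`HD ∧ d ∈ K₂ ∧ r ~_Y s`» is «`r ~_Y s` and
the `W`-defect». -/
lemma hdKY_iff_of_mem_groupInterval (hr : d ≠ r) (hs : d ≠ s) (hpd : p ≠ d) (hqd : q ≠ d)
    {ρ : Config E} (hρ : ρ ∈ RepP ends p q r s d) {x y : Finset (Finset V) × Finset E}
    (hx : x ∈ cubeP ends d r s ρ) (hsepx : sep2 ends p q r s (assignX ends x ρ))
    (hKx : d ∈ K2 ends r s (assignX ends x ρ)) (hy : y ∈ groupInterval ends d r s ρ x) :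
    (HD ends p q r s d (assignX ends y ρ) ∧ d ∈ K2 ends r s (assignX ends y ρ) ∧
        Conn ends (assignX ends y ρ) r s) ↔
      (Conn ends (assignX ends y ρ) r s ∧ WDefect ends p q r s d (assignX ends y ρ)) := by
  obtain ⟨hsep, hD, hK, hM⟩ := kside_of_mem_groupInterval hr hs hpd hqd hρ hx hsepx hKx hy
  constructor
  · rintro ⟨hHD, _, hrs⟩
    obtain ⟨_, _, hone⟩ := hd_iff.1 hHD
    rcases hone with ⟨_, _, hW⟩ | ⟨hM', _⟩
    · exact ⟨hrs, hW⟩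
    · exact absurd hM' hM
  · rintro ⟨hrs, hW⟩
    refine ⟨⟨hsep, hD, Or.inl hK, not_L_of_WDefect hW⟩, hK, hrs⟩

/-- **The `K`-side `HD` colourings with `r ~_Y s` form a down-set of the group interval.** -/
theorem hdKY_anti_of_mem_groupInterval (hr : d ≠ r) (hs : d ≠ s) (hpd : p ≠ d) (hqd : q ≠ d)
    {ρ : Config E} (hρ : ρ ∈ RepP ends p q r s d) {x y y' : Finset (Finset V) × Finset E}
    (hx : x ∈ cubeP ends d r s ρ) (hsepx : sep2 ends p q r s (assignX ends x ρ))
    (hKx : d ∈ K2 ends r s (assignX ends x ρ)) (hy : y ∈ groupInterval ends d r s ρ x)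
    (hy' : y' ∈ groupInterval ends d r s ρ x) (hyy' : y ≤ y')
    (h : HD ends p q r s d (assignX ends y' ρ) ∧ d ∈ K2 ends r s (assignX ends y' ρ) ∧
      Conn ends (assignX ends y' ρ) r s) :
    HD ends p q r s d (assignX ends y ρ) ∧ d ∈ K2 ends r s (assignX ends y ρ) ∧
      Conn ends (assignX ends y ρ) r s := by
  obtain ⟨hrs', hW'⟩ := (hdKY_iff_of_mem_groupInterval hr hs hpd hqd hρ hx hsepx hKx hy').1 h
  refine (hdKY_iff_of_mem_groupInterval hr hs hpd hqd hρ hx hsepx hKx hy).2 ⟨?_, ?_⟩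
  · exact conn_rs_assignX_anti' hr hs hρ hyy' (mem_cubeP_of_mem_groupInterval hy)
      (mem_cubeP_of_mem_groupInterval hy') hrs'
  · exact wDefect_anti_of_mem_groupInterval hr hs hpd hqd hρ hx hKx hy hy' hyy' hW'

end Anti

end NoPocket

end Summit.Ventures.PercRepro2
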